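import Summits.BirchSwinnertonDyer.BirchSwinnertonDyer.Theorems.ByReductionTypeAtTwoSupersingularFlatImageDoor
import Summits.BirchSwinnertonDyer.BirchSwinnertonDyer.Theorems.ByReductionTypeAtTwoSupersingularFlatCapstoneCore
import Summits.BirchSwinnertonDyer.BirchSwinnertonDyer.Theorems.ByReductionTypeAtTwoSupersingularFlatReciprocityConstantPeriod
import Summits.BirchSwinnertonDyer.BirchSwinnertonDyer.Theorems.ByReductionTypeAtTwoSupersingularFlatRoad
import Summits.BirchSwinnertonDyer.BirchSwinnertonDyer.Theorems.ByReductionTypeAtTwoSupersingularHondaSystemAtTwoLogsAdic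
import Summits.BirchSwinnertonDyer.BirchSwinnertonDyer.Theorems.ThetaPartnerAtTwoSignedKatoUpToAtTwoLocalCyclotomicVariable
import Summits.BirchSwinnertonDyer.BirchSwinnertonDyer.Theorems.ThetaPartnerAtTwoSignedKatoUpToAtTwoKatoBKCuspBrick
import Literature.NumberTheory.EllipticCurves.Kato2004.EulerSystemTatePairingValuesTwo
import HarnessLib

/-!
# Crux `SupersingularRankZeroAtTwo` (K4, item stmt-BirchSwinnertonDyer-19097), line `odd_blind_package` v2.20 (39efd4f3) → v2.21,
# stub 2/5 `stub_flatPackage : FlatZetaPackageAtTwo` — FILE C3d of hand «hF3-CAP» (LEAD ss-1 GEN 26 ask 00:26:59Z): THE BODY OF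
# `FlatZetaPackageAtTwo` WITH F3b EXACT, from the two print names, Abbes–Ullmo Thm. A, and the research conjunct (α)
# «∃ e ∈ 𝐇¹, Col♭(L e) ∉ 2Λ» for every Honda system at two

Seat `bsd-2adic-t42` GEN 52 (pen GEN 41 SUMMON 20260831T234826Z; LEAD ss-1 GEN 26 «ONE MORE FILE MAKES v2.21 = (α)»; director-bsd g27
(1009)(a)/(1010)(a), (1017)(b)).  HONEST FRAMING (D-0054): THEOREMS ONLY — no definition, no named fact, no instance, no notation, no
`sorry`.  CONSUMER: the three print inputs are NAMED hypotheses ((P) `Kato2004.exists_eulerSystem_expStar_tatePairing_values_two`, (R)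
`Kato2004.thm12_4`, (AU) `ModularForms.abbesUllmo_not_dvd_maninConstant_of_not_dvd_level`) and the research conjunct (α) is a displayed
hypothesis in exactly the tokens the LEAD names for `def FlatColemanImagePrimitiveAtTwo`; no Kato value is computed, no logarithm unfolded,
no modular symbol evaluated.  Helper toward stub 2; closes NO stub by itself (stub 2 closes only when the LEAD's v2.21 glue lands AND (α)
is discharged or re-homed); 19097 stays OPEN on its 5 registered stubs (v2.20 39efd4f3); nothing booked; BSD₂ is proved for no supersingular
curve and BSD for no curve by any of this; typed ≠ proved.  `bears_on: K4 (19097) (8) F3 / v2.21`.  Everything here is at `p = 2`.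

## What

★★★ `SSFlatCap.flatZetaPackage_body_of_flatImage (hP) (h124) (hAU) (W) … (hr) (hss) (κ γ hκ hγ hγ') (v hv) (g hg) (hα)` — LITERALLY the body of
`FlatZetaPackageAtTwo` after its outer binders (v2.20 :1563–1589; F3b EXACT `ι G = C ϖ · ι L♭`).  (α) is f-free and quantified over ALL Honda
systems `(cneg, c)` at two for `g`, all `T₂W` instances, every pin `I`, every PINNED `L` and every PINNED `J`:
`∃ e : I.H, (J (L e)).2 ∉ Ideal.span {C 2}` (μ-primitivity of the ♭ Coleman image of `𝐇¹(T₂E)`; invariant under every rescaling of the print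
∃-families — pen RC-860/861).  PROOF = C3c's `flatZetaPackage_body_pow_two_of_print` VERBATIM up to its last line (E0b
`SSHondaTwo.isHondaSystemAtTwo_sprung_withLog` → `LocalVar.exists_localVariable_two` → K3 frames → (P) → `KatoConst.exists_ratCast_eq_katoConstant_of_analyticRank_eq_zero`
→ `KatoBK.cuspBrick_of_isNewformOf` per height-one `𝔭 ∌ 2` → C3a ★★ `exists_lifts_levelCongruences_of_katoFamily` (hE3) → C2 ★★ `hcop_of_cuspFamily` (hcop)),
then `0 ≤ v₂(ϖ)` from tower-1 GEN 70 ★ `SSFlatERL.padicValRat_periodRatio_nonneg_of_goodSS_two_of_abbesUllmo` (the f-block's period relation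
`(ϖ:ℝ)·Ω_W = Ω⁺_f` is consumed here) and the LEAD's (α) door ★★★ `SSFlatFold.flatZeta_fblock_of_levelCongruences_of_flatImage` (p838…,
`…FlatImageDoor`) with `hα` instantiated at E0b's `(cneg, c)`.

References: [Kato2004Asterisque] K. Kato, Astérisque 295 (2004), Thm. 12.4–12.6 (pp. 221–222), Thm. 6.6 (1), Thm. 9.7, Ex. 13.3
(p. 225), §13.9–13.14 (pp. 229–234); [Sprung2012] F. Sprung, J. Number Theory 132 (2012), Thm. 2.2, Def. 3.1, Def. 5.9, Def. 7.1,
Thm. 7.14, 7.16; [Sprung2017] Thm. 1.12, Cor. 4.4–4.5; [Kobayashi2003] Thm. 6.3, (8.23), Prop. 8.25–8.26; [BlochKato1990] §3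
(3.10.1), (3.11); [AbbesUllmo1996] Thm. A; [RohrlichInventiones1984] Theorem (p. 409).
-/

set_option autoImplicit false
-- the Theorems namespace of this sub repeats the summit name by design (D-0017 nested layout)
set_option linter.dupNamespace false

noncomputable section

set_option backward.isDefEq.respectTransparency false

open scoped Classical MatrixGroups ModularForm NumberField TensorProduct

namespace Summit.BirchSwinnertonDyer.BirchSwinnertonDyer.Theorems.SSFlatCap

open CongruenceSubgroup WeierstrassCurve Field IsDedekindDomain NumberField Polynomial
  Literature.NumberTheory.GaloisRepresentations
  Literature.NumberTheory.EllipticCurves Literature.NumberTheory.EllipticCurves.ModularForms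
  Literature.NumberTheory.EllipticCurves.Module Literature.NumberTheory.EllipticCurves.Rank1Residual
  Literature.NumberTheory.EllipticCurves.Kobayashi2003 Literature.NumberTheory.EllipticCurves.Kato2004
  Literature.NumberTheory.EllipticCurves.Kato2004.EulerSystemValues Literature.NumberTheory.EllipticCurves.Sprung2012
  Literature.NumberTheory.EllipticCurves.Sprung2017
  Literature.NumberTheory.EllipticCurves.FormalGroupChart
  ZpExtension
  Summit.BirchSwinnertonDyer.Rank1Residual.Additive Summit.BirchSwinnertonDyer.Rank1Residual.Additive.PadicCyclotomicTower
  Summit.BirchSwinnertonDyer.Rank1Residual.Additive.BallEval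
  Summit.BirchSwinnertonDyer.Rank1Residual.F1Sign2
  Summit.BirchSwinnertonDyer.BirchSwinnertonDyer.Theorems.SignedKatoOffTwo.LocalTwo
  Summit.BirchSwinnertonDyer.BirchSwinnertonDyer.Theorems.SignedKatoOffTwo
  Summit.BirchSwinnertonDyer.BirchSwinnertonDyer.Theorems.SignedKatoOffTwo.KatoBK
  Summit.BirchSwinnertonDyer.BirchSwinnertonDyer.Theorems.SSFlatERL

/-- ★★★ **THE BODY OF `FlatZetaPackageAtTwo` (v2.20 :1563–1589), F3b EXACT, FROM PRINT + ABBES–ULLMO + (α).**  See the module docstring.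
[cite: Kato2004Asterisque, Thm. 12.4 (2), Thm. 12.5 (1)(4), Thm. 12.6 (pp. 221–222), §13.9, §13.12–13.14 (pp. 230–234)]
[cite: Sprung2012, Thm. 2.2, Def. 7.1 (p. 1500), Thm. 7.14, 7.16] [cite: Sprung2017, Thm. 1.12, Cor. 4.4–4.5] [cite: AbbesUllmo1996, Thm. A]
[cite: Kobayashi2003, Thm. 6.3, (8.23), Prop. 8.25] [cite: BlochKato1990, §3 (3.10.1), (3.11)] -/
theorem flatZetaPackage_body_of_flatImage (hP : Kato2004.exists_eulerSystem_expStar_tatePairing_values_two)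
    (h124 : Kato2004.thm12_4) (hAU : abbesUllmo_not_dvd_maninConstant_of_not_dvd_level)
    (W : WeierstrassCurve ℚ) [W.IsElliptic] [W.IsGloballyMinimal]
    (hr : W.analyticRank = 0) (hss : GoodSS W 2)
    (κ : ZpExtension ℚ 2) (γ : Field.absoluteGaloisGroup ℚ) (hκ : κ.IsCyclotomic) (hγ : κ.IsTopGenerator γ)
    (hγ' : IsCyclotomicVariable 2 γ) (v : HeightOneSpectrum (𝓞 ℚ)) (hv : (2 : 𝓞 ℚ) ∈ v.asIdeal)
    (g : Field.absoluteGaloisGroup (v.adicCompletion ℚ))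
    (hg : κ.IsTopGenerator (resGalOfEmb (closureEmb (K := ℚ) (v.adicCompletion ℚ)) g))
    (hα : ∀ (cneg : localPoints W (v.adicCompletion ℚ)) (c : ℕ → localPoints W (v.adicCompletion ℚ)),
      Summit.BirchSwinnertonDyer.Rank1Residual.F1Sign2.IsHondaSystemAtTwo κ
        (closureEmb (K := ℚ) (v.adicCompletion ℚ)) W (W.frobeniusTrace 2) g cneg c →
      ∀ [ContinuousSMul ℤ_[2] (W.tateModule 2)] [Module.Free ℤ_[2] (W.tateModule 2)]
        [Module.Finite ℤ_[2] (W.tateModule 2)] (I : Kato2004.IwasawaH1Data W 2 κ γ)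
        (L : letI := moduleOfGenerator κ (closureEmb (K := ℚ) (v.adicCompletion ℚ)) W hg
          I.H →ₗ[IwasawaAlgebra 2] (localTowerPointsOfEmb κ (closureEmb (K := ℚ) (v.adicCompletion ℚ)) W →+ ℤ_[2])),
        (∀ (x : I.H) (n k : ℕ) (Q : localPoints W (v.adicCompletion ℚ))
            (hQ : Q ∈ localLayerPointsOfEmb κ (closureEmb (K := ℚ) (v.adicCompletion ℚ)) W n),
            PadicInt.toZModPow k (L x ⟨Q, localLayerPointsOfEmb_le_localTowerPointsOfEmb κ _ W n hQ⟩) =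
              CyclotomicLayer.tatePairingPk W κ v n k (I.proj n x) ⟨Q, hQ⟩) →
      ∀ (J : letI := moduleOfGenerator κ (closureEmb (K := ℚ) (v.adicCompletion ℚ)) W hg
          (localTowerPointsOfEmb κ (closureEmb (K := ℚ) (v.adicCompletion ℚ)) W →+ ℤ_[2]) →ₗ[IwasawaAlgebra 2]
            IwasawaAlgebra 2 × IwasawaAlgebra 2),
        (∀ w, IsColemanPair κ (closureEmb (K := ℚ) (v.adicCompletion ℚ)) W (W.frobeniusTrace 2) g c w (J w).1 (J w).2) →
        ∃ e : I.H, (J (L e)).2 ∉ Ideal.span {(PowerSeries.C (2 : ℤ_[2]) : IwasawaAlgebra 2)}) :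
    ∃ (cneg : localPoints W (v.adicCompletion ℚ)) (c : ℕ → localPoints W (v.adicCompletion ℚ)),
      Summit.BirchSwinnertonDyer.Rank1Residual.F1Sign2.IsHondaSystemAtTwo κ
        (closureEmb (K := ℚ) (v.adicCompletion ℚ)) W (W.frobeniusTrace 2) g cneg c ∧
      (∀ [NeZero (W.conductorNorm ℤ)] (f : CuspForm (Gamma0 (W.conductorNorm ℤ)) 2),
          IsNewformOf W f → ∀ (ϖ : ℚ), (ϖ : ℝ) * W.realPeriodRat = plusPeriod f →
        ∀ (Ls Lf : IwasawaAlgebra 2), IsSprungPair f 2 (W.frobeniusTrace 2) Ls Lf →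
        ∀ [ContinuousSMul ℤ_[2] (W.tateModule 2)] [Module.Free ℤ_[2] (W.tateModule 2)]
          [Module.Finite ℤ_[2] (W.tateModule 2)] (I : Kato2004.IwasawaH1Data W 2 κ γ)
          (L : letI := moduleOfGenerator κ (closureEmb (K := ℚ) (v.adicCompletion ℚ)) W hg
            I.H →ₗ[IwasawaAlgebra 2] (localTowerPointsOfEmb κ (closureEmb (K := ℚ) (v.adicCompletion ℚ)) W →+ ℤ_[2])),
          (∀ (x : I.H) (n k : ℕ) (Q : localPoints W (v.adicCompletion ℚ))
              (hQ : Q ∈ localLayerPointsOfEmb κ (closureEmb (K := ℚ) (v.adicCompletion ℚ)) W n),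
              PadicInt.toZModPow k (L x ⟨Q, localLayerPointsOfEmb_le_localTowerPointsOfEmb κ _ W n hQ⟩) =
                CyclotomicLayer.tatePairingPk W κ v n k (I.proj n x) ⟨Q, hQ⟩) →
        ∀ (J : letI := moduleOfGenerator κ (closureEmb (K := ℚ) (v.adicCompletion ℚ)) W hg
            (localTowerPointsOfEmb κ (closureEmb (K := ℚ) (v.adicCompletion ℚ)) W →+ ℤ_[2]) →ₗ[IwasawaAlgebra 2]
              IwasawaAlgebra 2 × IwasawaAlgebra 2),
          (∀ w, IsColemanPair κ (closureEmb (K := ℚ) (v.adicCompletion ℚ)) W (W.frobeniusTrace 2) g c w (J w).1 (J w).2) →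
          ∃ (Z : Submodule (IwasawaAlgebra 2) I.H) (G : IwasawaAlgebra 2),
            (∃ z ∈ Z, (J (L z)).2 = G) ∧
            iwasawaToPowerSeries 2 G = PowerSeries.C (ϖ : ℚ_[2]) * iwasawaToPowerSeries 2 Lf ∧
            (∃ s₀ : I.H, Z = Submodule.span (IwasawaAlgebra 2) {s₀} ∧
              ∀ 𝔭 : PrimeSpectrum (IwasawaAlgebra 2), 𝔭.asIdeal.height = 1 →
                PowerSeries.C (2 : ℤ_[2]) ∉ 𝔭.asIdeal →
                ∃ (M : IwasawaAlgebra 2) (s : I.H), M ∉ 𝔭.asIdeal ∧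
                  Literature.NumberTheory.EllipticCurves.Kato2004.IsEulerSystemClassTwo W hκ I s ∧ s ≠ 0 ∧
                  M • s₀ = s)) := by
  -- E0b: THE Honda system with its model, logs and transport
  obtain ⟨Φ, φ, hΦφ, ι, hι, x, y, σ, N, d₀, cneg, c, hx, hyΩ, hystab, hσ, hN, hd₀, hL₀, -, hc, hH⟩ :=
    SSHondaTwo.isHondaSystemAtTwo_sprung_withLog W hss κ hκ v hv g hg
  refine ⟨cneg, c, hH, ?_⟩
  intro _ f hf ϖ hϖ Ls Lf hSP _ _ _ I L hLpin J hJ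
  -- the local variable and its lift; the frames
  obtain ⟨g₀, g₁, -, -, hg₁, -, -, hζpow, -, hTg⟩ := LocalVar.exists_localVariable_two hκ hγ hγ' v Φ φ hΦφ ι hι
  obtain ⟨e, he⟩ := exists_algHom_cyclotomicField_zeta_eq
  obtain ⟨τ, hτ⟩ := exists_tau_two
  obtain ⟨ιC, hιC⟩ := exists_ringHom_cyclotomicField_complex
  have heτ : ∀ (k : ℕ) (a : ZMod (2 ^ k)), IsUnit a →
      τ k a • e k (IsCyclotomicExtension.zeta (cycLevel 2 k ∅) ℚ (CyclotomicField (cycLevel 2 k ∅) ℚ)) =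
        e k (IsCyclotomicExtension.zeta (cycLevel 2 k ∅) ℚ (CyclotomicField (cycLevel 2 k ∅) ℚ)) ^ a.val := by
    intro k a ha; rw [he k]; exact hτ k a ha
  have hcoh : ∀ k : ℕ, e (k + 1) (IsCyclotomicExtension.zeta (cycLevel 2 (k + 1) ∅) ℚ (CyclotomicField (cycLevel 2 (k + 1) ∅) ℚ)) ^ 2 =
      e k (IsCyclotomicExtension.zeta (cycLevel 2 k ∅) ℚ (CyclotomicField (cycLevel 2 k ∅) ℚ)) := by
    intro k; rw [he, he]; exact zeta_succ_pow 2 k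
  -- (P): Kato's (KZ) family at this frame, and its rational constant
  have hv' : ((2 : ℕ) : 𝓞 ℚ) ∈ v.asIdeal := by exact_mod_cast hv
  obtain ⟨κK, hκK, ΛK, hfam⟩ := hP v hv' W hss κ hκ f hf Φ φ hΦφ e τ hcoh heτ ιC hιC
  have hKato : ∀ (c d a : ℤ) (A : ℕ), 0 < A → Int.gcd c (6 * 2 * A) = 1 → Int.gcd d (6 * 2 * W.conductorNorm ℤ) = 1 →
      ∃ (z : ∀ (k : ℕ) (r : (cyclotomicLevelsRat 2 (badPlaces c d A (W.conductorNorm ℤ))).Ideals),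
            H1 (tateRep W 2) ((cyclotomicLevelsRat 2 (badPlaces c d A (W.conductorNorm ℤ))).level k r.1))
        (x : ∀ (k : ℕ) (r : (cyclotomicLevelsRat 2 (badPlaces c d A (W.conductorNorm ℤ))).Ideals),
            CyclotomicField (cycLevel 2 k r.1) ℚ),
        ZetaBody W 2 f ιC κK ΛK c d a A z x := fun c d a A hA hc hd ↦ by
    obtain ⟨z, x, h, -⟩ := hfam c d a A hA hc hd
    exact ⟨z, x, h⟩
  obtain ⟨q, hq⟩ := KatoConst.exists_ratCast_eq_katoConstant_of_analyticRank_eq_zero hf hr 2 hKato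
  -- the cusp family: one datum per height-one prime away from `2` (brick B1, Rohrlich-free)
  have h2N : ¬ 2 ∣ W.conductorNorm ℤ := not_dvd_level_of_isNewformOf hf hss.1
  choose cδ dδ aδ eeδ dδ' Dδ μt hgc hgd hdd' _hD hμ hμt using
    fun 𝔭 : {𝔭 : PrimeSpectrum (IwasawaAlgebra 2) // 𝔭.asIdeal.height = 1 ∧ PowerSeries.C (2 : ℤ_[2]) ∉ 𝔭.asIdeal} ↦
      cuspBrick_of_isNewformOf hf h2N 𝔭.1 𝔭.2.1 𝔭.2.2
  -- the clauses of the Honda system E5 consumes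
  obtain ⟨-, hcL, -, -, hTr, -⟩ := id hH
  have hTR : ∀ n, localTraceOfEmb κ (closureEmb (K := ℚ) (v.adicCompletion ℚ)) W (n + 1) (n + 2) (c (n + 2)) =
      W.frobeniusTrace 2 • c (n + 1) - c n := fun n ↦ by
    have h := hTr (n + 1) (Nat.le_add_left 1 n)
    rwa [Nat.add_sub_cancel] at h
  obtain ⟨-, hrank⟩ := h124.isTorsionFree_and_rank_le_one W 2 hκ hγ I
  -- THE EXACT F3b: C3a (hE3) + C2 (hcop) + Abbes–Ullmo (`0 ≤ v₂(ϖ)`) + the LEAD's (α) door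
  letI := moduleOfGenerator κ (closureEmb (K := ℚ) (v.adicCompletion ℚ)) W hg
  obtain ⟨s, hES, hE3⟩ := exists_lifts_levelCongruences_of_katoFamily W hκ v hss Φ ι hx.1 hx.2.1 (hx.2.2 0) hN.1 hyΩ hystab hσ hd₀
    hL₀ hc hcL hTR hζpow hg₁ hg (hTg W) f hf I L hLpin e he τ hτ ιC hιC hq ΛK hfam cδ dδ aδ eeδ dδ' Dδ μt hgc hgd hdd' hμt
  have hap : (2 : ℤ) ∣ W.frobeniusTrace 2 := by exact_mod_cast hss.2
  have hq0 : q ≠ 0 := by rintro rfl; exact hκK (by exact_mod_cast hq)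
  have hN0 : (N : ℤ) ≠ 0 := by
    rcases Summit.BirchSwinnertonDyer.Rank1Residual.Supersingular.frobeniusTrace_two_eq_zero_or W hss.1 hap with h | h | h <;>
      · rw [hN.1, h]; norm_num
  have hNq : ((N : ℤ) * q.num : ℤ) ≠ 0 := mul_ne_zero hN0 (Rat.num_ne_zero.mpr hq0)
  have hLf : Lf ≠ 0 := SSFlatRoad.flat_ne_zero_two W hf hss.1 hap
    ((WeierstrassCurve.analyticRank_eq_zero_iff_holds (W := W) hf.hasEntireLFunction).mp hr) hSP
  have hd : ((q.den : ℤ) : ℤ_[2]) ≠ 0 := by exact_mod_cast q.den_ne_zero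
  have hcop := hcop_of_cuspFamily W hκ (closureEmb (K := ℚ) (v.adicCompletion ℚ)) hg hap I L J hJ f hSP hLf s hES Dδ μt hNq
    (fun 𝔭 h𝔭 h2 ↦ ⟨⟨𝔭, h𝔭, h2⟩, hμ ⟨𝔭, h𝔭, h2⟩⟩) hE3
  have hϖ2 : 0 ≤ padicValRat 2 ϖ := SSFlatERL.padicValRat_periodRatio_nonneg_of_goodSS_two_of_abbesUllmo hAU W hss f hf ϖ hϖ
  exact SSFlatFold.flatZeta_fblock_of_levelCongruences_of_flatImage W v hss hκ hγ hg hap I hrank L J hJ f ϖ Ls Lf hSP hLf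
    (fun δ ↦ (PowerSeries.C ((Dδ δ : ℤ) : ℤ_[2]) : IwasawaAlgebra 2) • s δ)
    (fun δ ↦ PowerSeries.C ((((N : ℤ) * q.num : ℤ) : ℤ_[2])) * μt δ) hd hE3 hcop (hα cneg c hH I L hLpin J hJ) hϖ2

end Summit.BirchSwinnertonDyer.BirchSwinnertonDyer.Theorems.SSFlatCap

end
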